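import Summits.QuantumFields.BalabanUV.Beta.GAN24.Push4Bounds

/-!
# `BalabanUV.Beta.GAN24.Push4NestAux` — binder row G-an2-4 / (CONV-C), W-slot road «W3» (SKELETON-W3 v0.2 §2 W3-L1): auxiliary bounds for the
# nesting law of the four-leg push — uniform / decay bounds of `vertexW`, `vertex2W`, `comp (Lk l) ·` from BOUNDED legs and a `LocStencil₂` table,
# the composite-leg localisation `legDecay_legComp`, and the ff-congruence of the push sandwich

NOT IN PRINT; OUR PROOF ATTEMPT (G-an2-4 formalisation swarm, leaf prover `b2b-balaban-gan24-formalise-leaf-17`, gen 14; names PROVISIONAL — the row owner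
gan24-p1 may rename / re-cut).  HONEST FRAMING (cell contract, verbatim): «discharging `BetaPertH` makes Bałaban's UV stability UNCONDITIONAL — a real
constructive-QFT result; it is NOT the continuum limit and NOT the Clay problem.»  HONEST DEPENDENCY (verbatim): «continuum YM on T⁴ ⇐ BetaPertH ∧ nine
spine estimates (0/9 proved); BetaPertH ⇐ (D1) ∧ (D4) ∧ CAP+tail; G-an2-4 gates asym, D1 and NE2/3/4.»

CONTENT ([folklore]; these are the majorants the dominated Fubini / re-association steps of `Push4Nest` consume).
* `abs_vertexW_slice_le` — `|vertexW r (X κ u) ν y′ x z a b| ≤ (d+1)·C_r·(C·Zl δ)·e^{−δ(|x−u|₁+|z−u|₁)}` for legs BOUNDED by `C_r` and `LocStencil₂ X C δ`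
  (the `r`-generic twin of BCJ's `abs_vertexOf_slice_le`); `summable_vertexW_slice`;
* `decays_vertexW_of_locStencil` — a local stencil family `|S κ u x z a b| ≤ K·e^{−δ(|x−u|₁+|z−u|₁)}` read through bounded legs decays in `|x − z|₁` at
  rate `δ/2` (constant `(d+1)·C_r·K·Zl(δ/2)`); `decays_vertex2W_of_bdd` (the bi-table case); `abs_le_of_decays`;
* `abs_comp_Lk_le_of_decays` — `|comp (Lk l) V x′ w a f| ≤ (d+1)·C_l·C_V·Zl δ′` for bounded left legs and a decaying `V`; `summable_Lk_row`, `summable_Rk_col`;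
* `legDecay_legComp` — COMPOSITE LEGS ARE LOCALISED: `LegDecay r₁ N₁ C₁ m₁ → LegDecay r₂ N₂ C₂ m₂ → (m′ ≤ m₂, m′·N₂ < m₁) →
  LegDecay (legComp r₂ r₁) (N₂·N₁) ((d+1)·C₁·C₂·Zl(m₁ − m′·N₂)) m′` (the rate in FINE units drops by the inner blocking — the composite column spreads
  over the composite block; the sharp (N1)/(N1′) data for an4's columns are road P1's, «W3-LEGS*»);
* `sandwich_congr_ff` — the push sandwich `ffRead (Lk l ∘ Y ∘ Rk r)` reads only the ff entries of `Y` (no hypothesis).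
0 cited facts, 0 `Prop` mirrors, 0 definitions, 0 sorry.  Asserts NO shape of Bałaban's tables; «T2Shape» / «T2SupRate» LOCATED / OPEN; discharges NOTHING of
(hW, hWall); NOT «W-slot closed», NEVER «G-an2-4 closed»; NOT BetaPertH, NOT continuum, NOT Clay.
-/

noncomputable section

open Finset
open scoped BigOperators
open Literature.MathematicalPhysics.QuantumFieldTheory
open Literature.MathematicalPhysics.QuantumFieldTheory.Balaban1983to89
open Literature.MathematicalPhysics.QuantumFieldTheory.Balaban1983to89.Beta
open B12Sec2to5 (l1 l1_nonneg)
open ExpKernelCalculus (MKer Decays BiLoc comp Zl Zl_nonneg l1_sub_triangle l1_sub_symm l1_natSmul summable_exp_shift summable_exp_shift'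
  tsum_exp_shift tsum_exp_shift')
open OneStepResolventKernel (Fib wsum LocStencil)
open KKTFluctuationEnergy (summable_mul_of_bdd)
open BalabanCompositeJets (LocStencil₂ abs_tsum_mul_le summable_slice_of_locStencil₂ tsum_abs_slice_le)
open Summit.QuantumFields.BalabanUV.Beta.GAN24.Push4 (legComp legComp_apply vertexW vertexW_apply vertex2W Lk Rk ffRead push₄
  Lk_inl_inl Lk_inl_inr Lk_inr Rk_inl_inl Rk_inr_left Rk_inr_right ffRead_inl_inl ffRead_inr_left ffRead_inr_right push₄_def)
open Summit.QuantumFields.BalabanUV.Beta.GAN24.Push4Bounds (LegDecay LegDecay.nonneg LegDecay.abs_le LegDecay.summable)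

namespace Summit.QuantumFields.BalabanUV.Beta.GAN24.Push4NestAux

variable {d : ℕ}
variable {r l r₁ r₂ : Fin (d + 1) → (Fin (d + 1) → ℤ) → Fin (d + 1) → (Fin (d + 1) → ℤ) → ℝ} {N N₁ N₂ : ℕ}
  {C Cr Cl C₁ C₂ m m₁ m₂ δ : ℝ}

/-! ## §1 Bounds of the generalised vertices from BOUNDED legs -/

/-- [folklore] **THE INNER VERTEX OF A SLICE, BOUNDED LEGS**: `|vertexW r (X κ u) ν y′ x z a b| ≤ (d+1)·C_r·(C·Zl δ)·e^{−δ(|x−u|₁ + |z−u|₁)}` (bounded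
weights × the `ℓ¹` mass of the slice; the `r`-generic twin of BCJ's `abs_vertexOf_slice_le`), uniformly in the coarse bond. -/
theorem abs_vertexW_slice_le (hr : ∀ μ y κ u, |r μ y κ u| ≤ Cr) (hCr : 0 ≤ Cr)
    {X : Fin (d + 1) → (Fin (d + 1) → ℤ) → Fin (d + 1) → (Fin (d + 1) → ℤ) → MKer (d + 1) (Fib d)} (hX : LocStencil₂ X C δ) (hδ : 0 < δ)
    (κ : Fin (d + 1)) (u : Fin (d + 1) → ℤ) (ν : Fin (d + 1)) (y' : Fin (d + 1) → ℤ) (x z : Fin (d + 1) → ℤ) (a b : Fib d) :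
    |vertexW r (X κ u) ν y' x z a b| ≤ (d + 1 : ℕ) * (Cr * (C * Zl (d + 1) δ)) * Real.exp (-δ * (l1 (x - u) + l1 (z - u))) := by
  rw [vertexW_apply]
  calc |∑ κ', ∑' u', r ν y' κ' u' * X κ u κ' u' x z a b| ≤ ∑ κ', |∑' u', r ν y' κ' u' * X κ u κ' u' x z a b| :=
        Finset.abs_sum_le_sum_abs _ _
    _ ≤ ∑ _κ' : Fin (d + 1), Cr * (C * Zl (d + 1) δ * Real.exp (-δ * (l1 (x - u) + l1 (z - u)))) :=
        Finset.sum_le_sum fun κ' _ =>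
          (abs_tsum_mul_le (fun u' => hr ν y' κ' u') (summable_slice_of_locStencil₂ hX hδ κ u κ' x z a b)).trans
            (mul_le_mul_of_nonneg_left (tsum_abs_slice_le hX hδ κ u κ' x z a b) hCr)
    _ = _ := by rw [Finset.sum_const, Finset.card_univ, Fintype.card_fin, nsmul_eq_mul]; ring

/-- [folklore] The slices of the family of inner vertices are summable in the first bond position. -/
theorem summable_vertexW_slice (hr : ∀ μ y κ u, |r μ y κ u| ≤ Cr) (hCr : 0 ≤ Cr)
    {X : Fin (d + 1) → (Fin (d + 1) → ℤ) → Fin (d + 1) → (Fin (d + 1) → ℤ) → MKer (d + 1) (Fib d)} (hX : LocStencil₂ X C δ) (hδ : 0 < δ)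
    (κ : Fin (d + 1)) (ν : Fin (d + 1)) (y' : Fin (d + 1) → ℤ) (x z : Fin (d + 1) → ℤ) (a b : Fib d) :
    Summable fun u => vertexW r (X κ u) ν y' x z a b := by
  refine Summable.of_norm_bounded ((summable_exp_shift hδ x).mul_left ((d + 1 : ℕ) * (Cr * (C * Zl (d + 1) δ)))) (fun u => ?_)
  rw [Real.norm_eq_abs]
  have h0 : 0 ≤ (d + 1 : ℕ) * (Cr * (C * Zl (d + 1) δ)) := by
    have := hX.nonneg; have := Zl_nonneg (D := d + 1) hδ; positivity
  refine (abs_vertexW_slice_le hr hCr hX hδ κ u ν y' x z a b).trans (mul_le_mul_of_nonneg_left (Real.exp_le_exp.2 ?_) h0)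
  nlinarith [l1_nonneg (z - u), l1_nonneg (x - u)]

/-- [folklore] **A LOCAL STENCIL FAMILY READ THROUGH BOUNDED LEGS DECAYS**: `|S κ u x z a b| ≤ K·e^{−δ(|x−u|₁+|z−u|₁)}` for all slices and `|r| ≤ C_r`
⟹ `Decays (vertexW r S μ y) ((d+1)·C_r·K·Zl(δ/2)) (δ/2)` (`|x−u| + |z−u| ≥ |x−z|`, half the rate kept for the sum over `u`). -/
theorem decays_vertexW_of_locStencil (hr : ∀ μ y κ u, |r μ y κ u| ≤ Cr) (hCr : 0 ≤ Cr)
    {S : Fin (d + 1) → (Fin (d + 1) → ℤ) → MKer (d + 1) (Fib d)} {K : ℝ} (hS : LocStencil S K δ) (hδ : 0 < δ) (μ : Fin (d + 1))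
    (y : Fin (d + 1) → ℤ) : Decays (vertexW r S μ y) ((d + 1 : ℕ) * (Cr * K * Zl (d + 1) (δ / 2))) (δ / 2) := by
  have hK : 0 ≤ K := (hS 0 0).nonneg (Sum.inl 0)
  intro x z a b
  rw [vertexW_apply]
  have hterm : ∀ κ, |∑' u, r μ y κ u * S κ u x z a b| ≤ Cr * K * Zl (d + 1) (δ / 2) * Real.exp (-(δ / 2) * l1 (x - z)) := by
    intro κ
    have hs := (summable_exp_shift (half_pos hδ) x).mul_left (Cr * K * Real.exp (-(δ / 2) * l1 (x - z)))
    have hb := tsum_of_norm_bounded hs.hasSum (f := fun u => r μ y κ u * S κ u x z a b) (fun u => by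
      rw [Real.norm_eq_abs, abs_mul]
      have h2 := hS κ u x z a b
      have hexp : Real.exp (-δ * (l1 (x - u) + l1 (z - u))) ≤ Real.exp (-(δ / 2) * l1 (x - z)) * Real.exp (-(δ / 2) * l1 (x - u)) := by
        rw [← Real.exp_add, Real.exp_le_exp]
        have t := l1_sub_triangle x u z
        rw [l1_sub_symm u z] at t
        nlinarith [l1_nonneg (x - u), l1_nonneg (z - u), hδ.le]
      calc |r μ y κ u| * |S κ u x z a b| ≤ Cr * (K * Real.exp (-δ * (l1 (x - u) + l1 (z - u)))) :=
            mul_le_mul (hr μ y κ u) h2 (abs_nonneg _) hCr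
        _ ≤ Cr * (K * (Real.exp (-(δ / 2) * l1 (x - z)) * Real.exp (-(δ / 2) * l1 (x - u)))) :=
            mul_le_mul_of_nonneg_left (mul_le_mul_of_nonneg_left hexp hK) hCr
        _ = _ := by ring)
    rw [Real.norm_eq_abs] at hb
    refine hb.trans (le_of_eq ?_)
    rw [tsum_mul_left, tsum_exp_shift]
    ring
  calc |∑ κ, ∑' u, r μ y κ u * S κ u x z a b| ≤ ∑ κ, |∑' u, r μ y κ u * S κ u x z a b| := Finset.abs_sum_le_sum_abs _ _
    _ ≤ ∑ _κ : Fin (d + 1), Cr * K * Zl (d + 1) (δ / 2) * Real.exp (-(δ / 2) * l1 (x - z)) := Finset.sum_le_sum fun κ _ => hterm κ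
    _ = _ := by rw [Finset.sum_const, Finset.card_univ, Fintype.card_fin, nsmul_eq_mul]; ring

/-- [folklore] **THE SECOND-ORDER VERTEX OF A `LocStencil₂` TABLE THROUGH BOUNDED LEGS DECAYS** in `|x − z|₁` at rate `δ/2`. -/
theorem decays_vertex2W_of_bdd (hr : ∀ μ y κ u, |r μ y κ u| ≤ Cr) (hCr : 0 ≤ Cr)
    {X : Fin (d + 1) → (Fin (d + 1) → ℤ) → Fin (d + 1) → (Fin (d + 1) → ℤ) → MKer (d + 1) (Fib d)} (hX : LocStencil₂ X C δ) (hδ : 0 < δ)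
    (μ : Fin (d + 1)) (y : Fin (d + 1) → ℤ) (ν : Fin (d + 1)) (y' : Fin (d + 1) → ℤ) :
    Decays (vertex2W r X μ y ν y') ((d + 1 : ℕ) * (Cr * ((d + 1 : ℕ) * (Cr * (C * Zl (d + 1) δ))) * Zl (d + 1) (δ / 2))) (δ / 2) :=
  decays_vertexW_of_locStencil hr hCr (S := fun κ u => vertexW r (X κ u) ν y')
    (fun κ u x z a b => abs_vertexW_slice_le hr hCr hX hδ κ u ν y' x z a b) hδ μ y

/-- [folklore] A decaying kernel (nonnegative rate) is uniformly bounded by its constant. -/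
theorem abs_le_of_decays {V : MKer (d + 1) (Fib d)} {CV δ' : ℝ} (hV : Decays V CV δ') (hδ' : 0 ≤ δ') (x z : Fin (d + 1) → ℤ)
    (a b : Fib d) : |V x z a b| ≤ CV := by
  refine (hV x z a b).trans ?_
  have hCV : 0 ≤ CV := hV.nonneg a
  have : Real.exp (-δ' * l1 (x - z)) ≤ 1 := by rw [Real.exp_le_one_iff]; nlinarith [l1_nonneg (x - z)]
  nlinarith

/-! ## §2 The left leg kernel against a decaying kernel; summability of leg-kernel rows and columns -/

/-- [folklore] **BOUNDED LEFT LEGS AGAINST A DECAYING KERNEL**: `|comp (Lk l) V x′ w a f| ≤ (d+1)·C_l·C_V·Zl δ′`. -/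
theorem abs_comp_Lk_le_of_decays (hl : ∀ α x' κ x, |l α x' κ x| ≤ Cl) (hCl : 0 ≤ Cl) {V : MKer (d + 1) (Fib d)} {CV δ' : ℝ}
    (hV : Decays V CV δ') (hδ' : 0 < δ') (x' w : Fin (d + 1) → ℤ) (a f : Fib d) :
    |comp (Lk l) V x' w a f| ≤ (d + 1 : ℕ) * (Cl * CV * Zl (d + 1) δ') := by
  have hCV : 0 ≤ CV := hV.nonneg (Sum.inl 0)
  have hZ : 0 ≤ Zl (d + 1) δ' := Zl_nonneg hδ'
  rcases a with α | μ'
  · unfold comp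
    have hpt : ∀ x : Fin (d + 1) → ℤ, |∑ g : Fib d, Lk l x' x (Sum.inl α) g * V x w g f| ≤ (d + 1 : ℕ) * (Cl * CV) * Real.exp (-δ' * l1 (x - w)) := by
      intro x
      rw [Fintype.sum_sum_type]
      simp only [Lk_inl_inr, zero_mul, Finset.sum_const_zero, add_zero]
      calc |∑ κ : Fin (d + 1), Lk l x' x (Sum.inl α) (Sum.inl κ) * V x w (Sum.inl κ) f|
          ≤ ∑ κ : Fin (d + 1), |Lk l x' x (Sum.inl α) (Sum.inl κ) * V x w (Sum.inl κ) f| := Finset.abs_sum_le_sum_abs _ _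
        _ ≤ ∑ _κ : Fin (d + 1), Cl * (CV * Real.exp (-δ' * l1 (x - w))) := Finset.sum_le_sum fun κ _ => by
            rw [abs_mul, Lk_inl_inl]
            exact mul_le_mul (hl α x' κ x) (hV x w _ f) (abs_nonneg _) hCl
        _ = _ := by rw [Finset.sum_const, Finset.card_univ, Fintype.card_fin, nsmul_eq_mul]; ring
    have hs := (summable_exp_shift' hδ' w).mul_left ((d + 1 : ℕ) * (Cl * CV))
    have hb := tsum_of_norm_bounded hs.hasSum (fun x => by rw [Real.norm_eq_abs]; exact hpt x)
    rw [Real.norm_eq_abs] at hb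
    refine hb.trans (le_of_eq ?_)
    rw [tsum_mul_left, tsum_exp_shift']
    ring
  · unfold comp
    simp only [Lk_inr, zero_mul, Finset.sum_const_zero, tsum_zero, abs_zero]
    positivity

/-- [folklore] The rows of a left leg kernel are summable when the legs are summable in their fine index. -/
theorem summable_Lk_row (hl : ∀ α x' κ, Summable fun x => l α x' κ x) (x' : Fin (d + 1) → ℤ) (a f : Fib d) :
    Summable fun x => Lk l x' x a f := by
  rcases a with α | μ'
  · rcases f with κ | ν
    · exact (hl α x' κ).congr fun x => by rw [Lk_inl_inl]
    · exact (summable_zero).congr fun x => by rw [Lk_inl_inr]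
  · exact (summable_zero).congr fun x => by rw [Lk_inr]

/-- [folklore] The columns of a right leg kernel are summable when the legs are summable in their fine index. -/
theorem summable_Rk_col (hr : ∀ β z' κ, Summable fun z => r β z' κ z) (z' : Fin (d + 1) → ℤ) (f b : Fib d) :
    Summable fun z => Rk r z z' f b := by
  rcases f with κ | μ'
  · rcases b with β | ν
    · exact (hr β z' κ).congr fun z => by rw [Rk_inl_inl]
    · exact (summable_zero).congr fun z => by rw [Rk_inr_right]
  · exact (summable_zero).congr fun z => by rw [Rk_inr_left]

/-! ## §3 Composite legs are localised -/

/-- [folklore] **COMPOSITE LEGS ARE LOCALISED** at the composite dilated point: `LegDecay r₁ N₁ C₁ m₁`, `LegDecay r₂ N₂ C₂ m₂`, `0 ≤ m′ ≤ m₂`,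
`m′·N₂ < m₁` ⟹ `LegDecay (legComp r₂ r₁) (N₂·N₁) ((d+1)·C₁·C₂·Zl(m₁ − m′·N₂)) m′` (`|u − N₂N₁•y| ≤ |u − N₂•v| + N₂·|v − N₁•y|`). -/
theorem legDecay_legComp (h₁ : LegDecay r₁ N₁ C₁ m₁) (h₂ : LegDecay r₂ N₂ C₂ m₂) {m' : ℝ} (hm'0 : 0 ≤ m') (hm'₂ : m' ≤ m₂)
    (hm'₁ : m' * N₂ < m₁) : LegDecay (legComp r₂ r₁) (N₂ * N₁) ((d + 1 : ℕ) * (C₁ * C₂ * Zl (d + 1) (m₁ - m' * N₂))) m' := by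
  intro μ y κ u
  have hC₁ := h₁.nonneg
  have hC₂ := h₂.nonneg
  rw [legComp_apply]
  have hpt : ∀ v : Fin (d + 1) → ℤ, |∑ lam : Fin (d + 1), r₁ μ y lam v * r₂ lam v κ u|
      ≤ (d + 1 : ℕ) * (C₁ * C₂) * Real.exp (-m' * l1 (u - ((N₂ * N₁ : ℕ) : ℤ) • y)) * Real.exp (-(m₁ - m' * N₂) * l1 (v - (N₁ : ℤ) • y)) := by
    intro v
    have hexp : Real.exp (-m₁ * l1 (v - (N₁ : ℤ) • y)) * Real.exp (-m₂ * l1 (u - (N₂ : ℤ) • v))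
        ≤ Real.exp (-m' * l1 (u - ((N₂ * N₁ : ℕ) : ℤ) • y)) * Real.exp (-(m₁ - m' * N₂) * l1 (v - (N₁ : ℤ) • y)) := by
      rw [← Real.exp_add, ← Real.exp_add, Real.exp_le_exp]
      have t := l1_sub_triangle u ((N₂ : ℤ) • v) (((N₂ * N₁ : ℕ) : ℤ) • y)
      have hd : l1 ((N₂ : ℤ) • v - ((N₂ * N₁ : ℕ) : ℤ) • y) = (N₂ : ℝ) * l1 (v - (N₁ : ℤ) • y) := by
        rw [show ((N₂ * N₁ : ℕ) : ℤ) • y = (N₂ : ℤ) • ((N₁ : ℤ) • y) by rw [Nat.cast_mul, mul_smul], ← smul_sub, l1_natSmul]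
      rw [hd] at t
      have hN₂ : (0 : ℝ) ≤ N₂ := Nat.cast_nonneg _
      nlinarith [mul_nonneg hm'0 (show 0 ≤ l1 (u - (N₂ : ℤ) • v) + (N₂ : ℝ) * l1 (v - (N₁ : ℤ) • y) - l1 (u - ((N₂ * N₁ : ℕ) : ℤ) • y)
        by linarith), mul_nonneg (show 0 ≤ m₂ - m' by linarith) (l1_nonneg (u - (N₂ : ℤ) • v))]
    calc |∑ lam : Fin (d + 1), r₁ μ y lam v * r₂ lam v κ u| ≤ ∑ lam : Fin (d + 1), |r₁ μ y lam v * r₂ lam v κ u| :=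
          Finset.abs_sum_le_sum_abs _ _
      _ ≤ ∑ _lam : Fin (d + 1), (C₁ * Real.exp (-m₁ * l1 (v - (N₁ : ℤ) • y))) * (C₂ * Real.exp (-m₂ * l1 (u - (N₂ : ℤ) • v))) :=
          Finset.sum_le_sum fun lam _ => by
            rw [abs_mul]; exact mul_le_mul (h₁ μ y lam v) (h₂ lam v κ u) (abs_nonneg _) (by positivity)
      _ = (d + 1 : ℕ) * (C₁ * C₂) * (Real.exp (-m₁ * l1 (v - (N₁ : ℤ) • y)) * Real.exp (-m₂ * l1 (u - (N₂ : ℤ) • v))) := by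
          rw [Finset.sum_const, Finset.card_univ, Fintype.card_fin, nsmul_eq_mul]; ring
      _ ≤ (d + 1 : ℕ) * (C₁ * C₂) * (Real.exp (-m' * l1 (u - ((N₂ * N₁ : ℕ) : ℤ) • y)) *
            Real.exp (-(m₁ - m' * N₂) * l1 (v - (N₁ : ℤ) • y))) := mul_le_mul_of_nonneg_left hexp (by positivity)
      _ = _ := by ring
  have hs := (summable_exp_shift' (show 0 < m₁ - m' * N₂ by linarith) ((N₁ : ℤ) • y)).mul_left
    ((d + 1 : ℕ) * (C₁ * C₂) * Real.exp (-m' * l1 (u - ((N₂ * N₁ : ℕ) : ℤ) • y)))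
  have hb := tsum_of_norm_bounded hs.hasSum (fun v => by rw [Real.norm_eq_abs]; exact hpt v)
  rw [Real.norm_eq_abs] at hb
  refine hb.trans (le_of_eq ?_)
  rw [tsum_mul_left, tsum_exp_shift']
  ring

/-! ## §4 The push sandwich reads only the ff entries of its middle kernel -/

/-- [folklore] **ff-CONGRUENCE OF THE PUSH SANDWICH**: if two kernels agree on their field–field entries then
`ffRead (comp (comp (Lk l) Y) (Rk r)) = ffRead (comp (comp (Lk l) Y′) (Rk r))` (the leg kernels see nothing else; no hypothesis). -/
theorem sandwich_congr_ff {Y Y' : MKer (d + 1) (Fib d)} (h : ∀ x z α β, Y x z (Sum.inl α) (Sum.inl β) = Y' x z (Sum.inl α) (Sum.inl β)) :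
    ffRead (comp (comp (Lk l) Y) (Rk r)) = ffRead (comp (comp (Lk l) Y') (Rk r)) := by
  have hin : ∀ x' z α κ, comp (Lk l) Y x' z (Sum.inl α) (Sum.inl κ) = comp (Lk l) Y' x' z (Sum.inl α) (Sum.inl κ) := by
    intro x' z α κ
    simp only [comp]
    refine tsum_congr fun x => ?_
    rw [Fintype.sum_sum_type, Fintype.sum_sum_type]
    simp only [Lk_inl_inl, Lk_inl_inr, zero_mul, Finset.sum_const_zero, add_zero, h]
  funext x' z' a b
  rcases a with α | μ
  · rcases b with β | ν
    · rw [ffRead_inl_inl, ffRead_inl_inl]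
      simp only [comp] at hin ⊢
      refine tsum_congr fun z => ?_
      rw [Fintype.sum_sum_type, Fintype.sum_sum_type]
      simp only [Rk_inl_inl, Rk_inr_left, mul_zero, Finset.sum_const_zero, add_zero]
      exact Finset.sum_congr rfl fun κ _ => by rw [hin]
    · rw [ffRead_inr_right, ffRead_inr_right]
  · rw [ffRead_inr_left, ffRead_inr_left]

/-- [folklore] In particular the inner `ffRead` of a nested sandwich may be dropped. -/
theorem sandwich_ffRead (Y : MKer (d + 1) (Fib d)) :
    ffRead (comp (comp (Lk l) (ffRead Y)) (Rk r)) = ffRead (comp (comp (Lk l) Y) (Rk r)) :=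
  sandwich_congr_ff fun x z α β => ffRead_inl_inl Y x z α β

end Summit.QuantumFields.BalabanUV.Beta.GAN24.Push4NestAux

end
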